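import Literature.NumberTheory.Irrationality.KrattenthalerRivoal2007.DenominatorsTheorem
import Literature.NumberTheory.Irrationality.Hata1992.FractionalPartWindows
import HarnessLib

/-!
# The size of Krattenthaler–Rivoal's `p`-adic factors `Φ̃_n`, `Φ_n`: `(log Φ̃_n)/n → ψ(2) − ψ(5/3)`, `(log Φ_n)/n → ψ(1) − ψ(2/3)`

Topic `Literature/NumberTheory/Irrationality/KrattenthalerRivoal2007`. Companion of `DenominatorsTheorem.lean`
(named fact `theoreme5` = [KrattenthalerRivoal2007, §3 Théorème 5]: the common saving `Φ̃_n^{B-1}` of the symmetric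
very-well-poised forms with `r = 1`). HONEST FRAMING (cell zeta5-irr, inherited from pub-zeta5): systematic search;
no irrationality claim unless certified — nothing here concerns the arithmetic nature of any constant.

Krattenthaler–Rivoal's factors are `Φ_n = ∏_{p prime, {n/p} ∈ [2/3,1)} p` [§2.4 (eq:Phi)] and
`Φ̃_n = ∏_{p prime, p < n, {n/p} ∈ [2/3,1)} p` [§3, before Théorème 5] (`PhiKR`, `PhiTildeKR`). Writing
`k = ⌊n/p⌋`, the condition `{n/p} ∈ [2/3, 1)` says `n/(k+1) < p ≤ n/(k+2/3)`, i.e. `p` lies in the `k`-th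
fractional-part WINDOW of the tree's `Hata1992/FractionalPartWindows.lean` with `(u,v) = (2/3, 1)`; `p < n` is
`k ≥ 1` and "all primes" is `k ≥ 0` (the window `k = 0` is `n < p ≤ 3n/2`). Hence (PROVED here, no facts):

* `PhiTildeKR_eq_fracProd : Φ̃_n = fracProd (2/3) 1 1 n`, `PhiKR_eq_fracProd : Φ_n = fracProd (2/3) 1 0 n`
  (equalities of natural numbers: the same primes, grouped by `k = ⌊n/p⌋`);
* `tendsto_log_PhiTildeKR_div : (log Φ̃_n)/n → Re(ψ(2) − ψ(5/3))` and
  `tendsto_log_PhiKR_div : (log Φ_n)/n → Re(ψ(1) − ψ(2/3))`, from the tree's fractional-part window theorem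
  `Hata1992.tendsto_log_fracProd_div_digamma` (prime number theorem window by window + Chebyshev tail)
  [cite: Hata1992, §2 pp. 340–341; Zudilin2004, Lemma 11 (5.8)] — the series form of the limits is
  `Σ_{k≥1} (1/(k+2/3) − 1/(k+1))` resp. `Σ_{k≥0} (1/(k+2/3) − 1/(k+1))` (`Hata1992.fracRate`).

Numerically `ψ(2) − ψ(5/3) = 0.24101…` and `ψ(1) − ψ(2/3) = (3/2) log 3 − π/(2√3) = 0.74101…` (not asserted in
Lean). KR do not print these limits; they print the consequence "il s'en faut d'extrêmement peu … `liminf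
Φ̃_n^{-2} d_n^{17} S̃_{n,16}(1) ≈ 1.007`" [cite: KrattenthalerRivoal2007, §4 Remarque after Théorème 7 (p. 9)], and
Zudilin's original `Φ_n` statement for `S_{n,4,2,1,1}` is [cite: Zudilin2003WellPoised, §2 (25)] as reported in
[KrattenthalerRivoal2007, §2.4]. This file supplies the PROVED rate a user of `theoreme5` needs to turn the
divisibility into nats per unit `n` (zeta5-irr zi-lit LIT-ZI.md D4; zi-p2 LEMMAS.md A2).
-/

noncomputable section

open Finset Filter Real
open scoped Topology

namespace Literature.NumberTheory.Irrationality.KrattenthalerRivoal2007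

open Literature.NumberTheory.Irrationality.Hata1992

/-! ### The window description of `{n/p} ∈ [2/3, 1)` -/

/-- Integer form of the `k`-th window: for `p > 0`, `⌊n/p⌋ = k ∧ {n/p} ≥ 2/3` iff
`p k ≤ n < p k + p` and `3 p k + 2 p ≤ 3 n`. [cite: KrattenthalerRivoal2007, §2.4 eq. (eq:Phi)] -/
theorem div_eq_and_frac_iff {n p : ℕ} (hp : 0 < p) (k : ℕ) :
    (n / p = k ∧ fracGeTwoThirds n p) ↔ (p * k ≤ n ∧ n < p * k + p ∧ 3 * (p * k) + 2 * p ≤ 3 * n) := by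
  unfold fracGeTwoThirds
  have hdm : p * (n / p) + n % p = n := Nat.div_add_mod n p
  have hml : n % p < p := Nat.mod_lt n hp
  constructor
  · rintro ⟨hk, hfr⟩
    subst hk
    refine ⟨?_, ?_, ?_⟩
    · omega
    · omega
    · omega
  · rintro ⟨h1, h2, h3⟩
    have hk : n / p = k := by
      refine Nat.div_eq_of_lt_le ?_ ?_
      · rw [mul_comm]; exact h1
      · rw [Nat.succ_mul, mul_comm]; exact h2
    refine ⟨hk, ?_⟩
    rw [hk] at hdm
    omega

/-- Real form of the same window: `p` lies in the tree's window `(n/(k+1), n/(k+2/3)]`, i.e. in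
`Hata1992.windowPrimes (1/(k+1)) (1/(k+2/3)) n`, iff `p` is a prime with `⌊n/p⌋ = k` and `{n/p} ≥ 2/3`.
[cite: KrattenthalerRivoal2007, §2.4 eq. (eq:Phi); Hata1992, §2 p. 340] -/
theorem mem_windowPrimes_twoThirds_iff (n k p : ℕ) :
    p ∈ windowPrimes (1 / ((k : ℝ) + 1)) (1 / ((k : ℝ) + 2 / 3)) n ↔
      (p.Prime ∧ n / p = k ∧ fracGeTwoThirds n p) := by
  have hk1 : (0 : ℝ) < (k : ℝ) + 1 := by positivity
  have hk23 : (0 : ℝ) < (k : ℝ) + 2 / 3 := by positivity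
  rw [mem_windowPrimes_iff (by positivity)]
  constructor
  · rintro ⟨hpr, h1, h2⟩
    refine ⟨hpr, (div_eq_and_frac_iff hpr.pos k).mpr ⟨?_, ?_, ?_⟩⟩
    · -- from `p ≤ n/(k+2/3)`: `p (k + 2/3) ≤ n`, a fortiori `p k ≤ n`
      rw [one_div_mul_eq_div, le_div_iff₀ hk23] at h2
      have : (p : ℝ) * k ≤ n := by nlinarith [(Nat.cast_nonneg p : (0 : ℝ) ≤ p)]
      exact_mod_cast this
    · rw [one_div_mul_eq_div, div_lt_iff₀ hk1] at h1
      have : (n : ℝ) < (p : ℝ) * k + p := by linarith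
      exact_mod_cast this
    · rw [one_div_mul_eq_div, le_div_iff₀ hk23] at h2
      have : (3 : ℝ) * ((p : ℝ) * k) + 2 * p ≤ 3 * n := by linarith
      exact_mod_cast this
  · rintro ⟨hpr, hk⟩
    obtain ⟨h1, h2, h3⟩ := (div_eq_and_frac_iff hpr.pos k).mp hk
    refine ⟨hpr, ?_, ?_⟩
    · rw [one_div_mul_eq_div, div_lt_iff₀ hk1]
      have : (n : ℝ) < (p : ℝ) * k + p := by exact_mod_cast h2
      linarith
    · rw [one_div_mul_eq_div, le_div_iff₀ hk23]
      have : (3 : ℝ) * ((p : ℝ) * k) + 2 * p ≤ 3 * n := by exact_mod_cast h3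
      linarith

/-- The windows with distinct `k` are disjoint (the window determines `k = ⌊n/p⌋`). [folklore] -/
private theorem pairwiseDisjoint_windowPrimes_twoThirds (n : ℕ) (s : Finset ℕ) :
    (s : Set ℕ).PairwiseDisjoint
      (fun k : ℕ => windowPrimes (1 / ((k : ℝ) + 1)) (1 / ((k : ℝ) + 2 / 3)) n) := by
  intro k _ k' _ hkk'
  rw [Function.onFun, Finset.disjoint_left]
  intro p hp hp'
  rw [mem_windowPrimes_twoThirds_iff] at hp hp'
  exact hkk' (hp.2.1.symm.trans hp'.2.1)

/-! ### `Φ̃_n` and `Φ_n` as fractional-part window products -/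

/-- The primes of `Φ̃_n` are exactly the primes of the windows `k = 1, …, n`.
[cite: KrattenthalerRivoal2007, §3 (definition of Φ̃_n)] -/
theorem filter_PhiTilde_eq_biUnion (n : ℕ) :
    (range n).filter (fun p => p.Prime ∧ fracGeTwoThirds n p) =
      (Ico 1 (n + 1)).biUnion
        (fun k : ℕ => windowPrimes (1 / ((k : ℝ) + 1)) (1 / ((k : ℝ) + 2 / 3)) n) := by
  ext p
  simp only [mem_filter, mem_range, mem_biUnion, mem_Ico, mem_windowPrimes_twoThirds_iff]
  constructor
  · rintro ⟨hpn, hpr, hfr⟩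
    refine ⟨n / p, ⟨?_, ?_⟩, hpr, rfl, hfr⟩
    · exact Nat.div_pos hpn.le hpr.pos
    · exact Nat.lt_succ_of_le (Nat.div_le_self n p)
  · rintro ⟨k, ⟨hk1, _⟩, hpr, hk, hfr⟩
    refine ⟨?_, hpr, hfr⟩
    obtain ⟨h1, _, _⟩ := (div_eq_and_frac_iff hpr.pos k).mp ⟨hk, hfr⟩
    have hfr' : 2 * p ≤ 3 * (n % p) := hfr
    -- `p ≤ p k ≤ n`, and `p ≠ n` since `n % n = 0`
    have hple : p ≤ n := le_trans (Nat.le_mul_of_pos_right p hk1) h1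
    rcases hple.lt_or_eq with hlt | heq
    · exact hlt
    · exfalso
      rw [heq, Nat.mod_self] at hfr'
      have := hpr.pos
      omega

/-- The primes of `Φ_n` are exactly the primes of the windows `k = 0, 1, …, n` (the window `k = 0` being
`n < p ≤ 3n/2`). [cite: KrattenthalerRivoal2007, §2.4 eq. (eq:Phi)] -/
theorem filter_Phi_eq_biUnion (n : ℕ) :
    (range (2 * n)).filter (fun p => p.Prime ∧ fracGeTwoThirds n p) =
      (Ico 0 (n + 1)).biUnion
        (fun k : ℕ => windowPrimes (1 / ((k : ℝ) + 1)) (1 / ((k : ℝ) + 2 / 3)) n) := by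
  ext p
  simp only [mem_filter, mem_range, mem_biUnion, mem_Ico, mem_windowPrimes_twoThirds_iff]
  constructor
  · rintro ⟨_, hpr, hfr⟩
    exact ⟨n / p, ⟨Nat.zero_le _, Nat.lt_succ_of_le (Nat.div_le_self n p)⟩, hpr, rfl, hfr⟩
  · rintro ⟨k, ⟨_, _⟩, hpr, hk, hfr⟩
    exact ⟨lt_two_mul_of_fracGeTwoThirds hpr hfr, hpr, hfr⟩

/-- **`Φ̃_n` is the fractional-part window product** `∏_{k=1}^{n} ∏_{n/(k+1) < p ≤ n/(k+2/3)} p` of the tree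
(`Hata1992.fracProd (2/3) 1 1 n`). [cite: KrattenthalerRivoal2007, §3 (definition of Φ̃_n); Hata1992, §2 p. 340] -/
theorem PhiTildeKR_eq_fracProd (n : ℕ) : PhiTildeKR n = fracProd (2 / 3 : ℝ) 1 1 n := by
  unfold PhiTildeKR fracProd fracWindow windowProd
  rw [filter_PhiTilde_eq_biUnion, prod_biUnion (pairwiseDisjoint_windowPrimes_twoThirds n _)]

/-- **`Φ_n` is the fractional-part window product** `∏_{k=0}^{n} ∏_{n/(k+1) < p ≤ n/(k+2/3)} p`
(`Hata1992.fracProd (2/3) 1 0 n`). [cite: KrattenthalerRivoal2007, §2.4 eq. (eq:Phi); Hata1992, §2 p. 340] -/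
theorem PhiKR_eq_fracProd (n : ℕ) : PhiKR n = fracProd (2 / 3 : ℝ) 1 0 n := by
  unfold PhiKR fracProd fracWindow windowProd
  rw [filter_Phi_eq_biUnion, prod_biUnion (pairwiseDisjoint_windowPrimes_twoThirds n _)]

/-! ### The rates -/

/-- **`(log Φ̃_n)/n → Σ_{k≥1} (1/(k+2/3) − 1/(k+1))`** (`Hata1992.fracRate (2/3) 1 1`), by the prime number theorem
window by window. [cite: Hata1992, §2 pp. 340–341; KrattenthalerRivoal2007, §3 Théorème 5 (the factor Φ̃_n)] -/
theorem tendsto_log_PhiTildeKR_div_fracRate :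
    Tendsto (fun n : ℕ => Real.log (PhiTildeKR n : ℕ) / n) atTop (𝓝 (fracRate (2 / 3 : ℝ) 1 1)) := by
  have h := tendsto_log_fracProd_div (u := (2 / 3 : ℝ)) (v := 1) (by norm_num) (by norm_num) le_rfl 1
  refine h.congr fun n => ?_
  rw [PhiTildeKR_eq_fracProd]

/-- **`(log Φ̃_n)/n → Re(ψ(2) − ψ(5/3))`** (`= 0.2410…`, not asserted): the size of Krattenthaler–Rivoal's saving
`Φ̃_n` in nats per unit `n`. [cite: Hata1992, §2 pp. 340–341; Zudilin2004, Lemma 11 (5.8);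
KrattenthalerRivoal2007, §3 Théorème 5] -/
theorem tendsto_log_PhiTildeKR_div :
    Tendsto (fun n : ℕ => Real.log (PhiTildeKR n : ℕ) / n) atTop
      (𝓝 ((Complex.digamma (2 : ℝ) - Complex.digamma (5 / 3 : ℝ)).re)) := by
  have h := tendsto_log_fracProd_div_digamma (u := (2 / 3 : ℝ)) (v := 1) (by norm_num) (by norm_num) le_rfl 1
  have e1 : ((1 : ℕ) : ℝ) + 1 = (2 : ℝ) := by norm_num
  have e2 : ((1 : ℕ) : ℝ) + 2 / 3 = (5 / 3 : ℝ) := by norm_num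
  rw [e1, e2] at h
  refine h.congr fun n => ?_
  rw [PhiTildeKR_eq_fracProd]

/-- **`(log Φ_n)/n → Σ_{k≥0} (1/(k+2/3) − 1/(k+1))`** (`Hata1992.fracRate (2/3) 1 0`).
[cite: Hata1992, §2 pp. 340–341; KrattenthalerRivoal2007, §2.4 eq. (eq:Phi) and §3 Théorème 4] -/
theorem tendsto_log_PhiKR_div_fracRate :
    Tendsto (fun n : ℕ => Real.log (PhiKR n : ℕ) / n) atTop (𝓝 (fracRate (2 / 3 : ℝ) 1 0)) := by
  have h := tendsto_log_fracProd_div (u := (2 / 3 : ℝ)) (v := 1) (by norm_num) (by norm_num) le_rfl 0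
  refine h.congr fun n => ?_
  rw [PhiKR_eq_fracProd]

/-- **`(log Φ_n)/n → Re(ψ(1) − ψ(2/3))`** (`= (3/2) log 3 − π/(2√3) = 0.7410…`, not asserted): the size of
Zudilin's / Krattenthaler–Rivoal's `Φ_n`. [cite: Hata1992, §2 pp. 340–341; Zudilin2004, Lemma 11 (5.8);
KrattenthalerRivoal2007, §2.4 eq. (eq:Phi)] -/
theorem tendsto_log_PhiKR_div :
    Tendsto (fun n : ℕ => Real.log (PhiKR n : ℕ) / n) atTop
      (𝓝 ((Complex.digamma (1 : ℝ) - Complex.digamma (2 / 3 : ℝ)).re)) := by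
  have h := tendsto_log_fracProd_div_digamma (u := (2 / 3 : ℝ)) (v := 1) (by norm_num) (by norm_num) le_rfl 0
  have e1 : ((0 : ℕ) : ℝ) + 1 = (1 : ℝ) := by norm_num
  have e2 : ((0 : ℕ) : ℝ) + 2 / 3 = (2 / 3 : ℝ) := by norm_num
  rw [e1, e2] at h
  refine h.congr fun n => ?_
  rw [PhiKR_eq_fracProd]

end Literature.NumberTheory.Irrationality.KrattenthalerRivoal2007
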